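import Literature.Topology.FourManifolds.GaussDiagramsReadOff
import Literature.Topology.FourManifolds.GaussDiagramsTransverse
import Literature.Topology.FourManifolds.KnotFlatArc
import HarnessLib

/-!
# Every knot is isotopic to one with a Gauss diagram: discharge of
# `Knot.exists_hasGaussDiagram_of_isIsotopic`

Topic `Literature/Topology/FourManifolds`; the assembly of the bricks `GaussDiagramsChart`,
`GaussDiagramsGenericity`, `GaussDiagramsTransverse`, `GaussDiagramsPerturbation`,
`GaussDiagramsReadOff` into the discharge of the named fact
`Literature.Topology.FourManifolds.Knot.exists_hasGaussDiagram_of_isIsotopic` of `GaussDiagrams.lean`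
(D-0014): **every knot `K : 𝕊¹ ↪ 𝕊³` is ambient isotopic to a knot in regular position with
respect to the stereographic projection from the north pole, which therefore has a Gauss
diagram** — Reidemeister, *Knotentheorie* (1932), Kap. I §1 ("Jeder Knoten besitzt eine reguläre
Projektion"); Cromwell, *Knots and Links* (2004), Thm. 3.2.1: "A tame link has a regular
projection" (held copy, PDF p. 46; the printed proof works piecewise linearly) and Def. 3.3.1
(diagrams); Rolfsen (1976), §3.E; Crowell–Fox, Ch. I §3.

**Proof** (smooth general position, Milnor, *Topology from the differentiable viewpoint*
(1965), §§2–3; Guillemin–Pollack (1974), Ch. 2 §3):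

1. move `K` off the north pole by an ambient isotopy (`Knot.exists_isIsotopic_forall_ne`,
   `KnotFlatArc.lean`, homogeneity of `𝕊³`);
2. in the stereographic chart the knot is a regular simple closed curve `(γ, h)`
   (`GaussDiagramsChart.lean`); every `C¹`-small smooth periodic perturbation of it is the chart
   curve of an ambient isotopic knot (`Knot.exists_isIsotopic_stereoCurve_add`,
   `GaussDiagramsPerturbation.lean`: `C¹`-stability of embedded curves, the straight-line smooth
   isotopy, and the isotopy extension theorem proved in `IsotopyExtension.lean`);
3. for Lebesgue-almost every small `(v, w) ∈ ℝ² × ℝ²` the perturbed plane curve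
   `γ + cos • v + sin • w` is an immersion with transverse double points only and no triple points
   (`exists_pert_generic`, `GaussDiagramsGenericity.lean` / `GaussDiagramsTransverse.lean`: easy
   Sard and Mathlib's fixed-dimension Sard theorem); perturb the plane curve by such a term and
   keep the height;
4. the resulting knot is in general position (`Knot.InGeneralPosition`) and its Gauss diagram is
   read off (`Knot.InGeneralPosition.hasGaussDiagram`, `GaussDiagramsReadOff.lean`).

Everything here is proved; no named facts are introduced; no statement of another file is
modified.

## References

* K. Reidemeister, *Knotentheorie*, Ergebnisse der Mathematik 1, Springer (1932), Kap. I §1.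
  [Reidemeister1932]
* P. R. Cromwell, *Knots and Links*, CUP (2004), Thm. 3.2.1, Def. 3.3.1 (held:
  `book:cromwell2004-knots-links`, PDF p. 46). [Cromwell2004]
* J. Milnor, *Topology from the differentiable viewpoint* (1965), §§2–3. [MilnorTDV1965]
* D. Rolfsen, *Knots and Links* (1976), §3.E. [Rolfsen1976]
-/

open scoped Manifold ContDiff Topology
open Function Set

noncomputable section

namespace Literature.Topology.FourManifolds

/-- Local notation: `𝔼 n` is the model Euclidean space `EuclideanSpace ℝ (Fin n)`. -/
local notation "𝔼 " n:arg => EuclideanSpace ℝ (Fin n)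

/-- Local notation: `𝕊 n` is the unit sphere in `EuclideanSpace ℝ (Fin (n + 1))`. -/
local notation "𝕊 " n:arg => (Metric.sphere (0 : EuclideanSpace ℝ (Fin (n + 1))) 1)

attribute [local instance] fact_finrank_euclideanSpace_two fact_finrank_euclideanSpace_four

/-- Two reals have the same point `(cos, sin)` on the circle iff their cosines and sines agree.
[folklore] -/
theorem circlePoint_eq_iff {s t : ℝ} :
    circlePoint s = circlePoint t ↔ Real.cos s = Real.cos t ∧ Real.sin s = Real.sin t := by
  constructor
  · intro h
    exact ⟨by rw [← circlePoint_apply_zero, ← circlePoint_apply_zero, h],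
      by rw [← circlePoint_apply_one, ← circlePoint_apply_one, h]⟩
  · rintro ⟨hc, hs⟩
    apply Subtype.ext
    ext i
    fin_cases i
    · simpa using hc
    · simpa using hs

namespace Knot

/-- **The perturbation term in the chart**: `P θ = (cos θ • v + sin θ • w, 0)` (plane part
perturbed by first harmonics, height kept), written through `pert` of
`GaussDiagramsGenericity.lean`. [folklore] -/
def pertTerm (γ : ℝ → ℝ × ℝ) (q : (ℝ × ℝ) × (ℝ × ℝ)) (θ : ℝ) : (ℝ × ℝ) × ℝ :=
  (pert γ q θ - γ θ, 0)

/-- The chart curve perturbed by `pertTerm`: plane part `pert γ q`, height unchanged. [folklore] -/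
theorem stereoCurve_add_pertTerm (K : Knot) (q : (ℝ × ℝ) × (ℝ × ℝ)) (θ : ℝ) :
    K.stereoCurve θ + pertTerm K.planeCurve q θ = (pert K.planeCurve q θ, K.heightCurve θ) := by
  simp only [stereoCurve, pertTerm, Prod.mk_add_mk, add_sub_cancel, add_zero]

/-- The perturbation term is `C^∞`. [folklore] -/
theorem contDiff_pertTerm {K : Knot} (hK : ∀ x, K x ≠ northPole) (q : (ℝ × ℝ) × (ℝ × ℝ)) :
    ContDiff ℝ ∞ (pertTerm K.planeCurve q) :=
  ((contDiff_pert (contDiff_planeCurve hK) q).sub (contDiff_planeCurve hK)).prodMk contDiff_const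

/-- The perturbation term is `2π`-periodic. [folklore] -/
theorem periodic_pertTerm (K : Knot) (q : (ℝ × ℝ) × (ℝ × ℝ)) :
    Periodic (pertTerm K.planeCurve q) (2 * Real.pi) := fun θ ↦ by
  simp only [pertTerm, periodic_pert K.periodic_planeCurve q θ, K.periodic_planeCurve θ]

/-- The size of the perturbation term: `‖P θ‖ ≤ ‖v‖ + ‖w‖`. [folklore] -/
theorem norm_pertTerm_le (K : Knot) (q : (ℝ × ℝ) × (ℝ × ℝ)) (θ : ℝ) :
    ‖pertTerm K.planeCurve q θ‖ ≤ ‖q.1‖ + ‖q.2‖ := by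
  rw [pertTerm, Prod.norm_mk, norm_zero, max_eq_left (norm_nonneg _)]
  exact norm_pert_sub_le q θ

/-- The derivative of the perturbation term. [folklore] -/
theorem hasDerivAt_pertTerm {K : Knot} (hK : ∀ x, K x ≠ northPole) (q : (ℝ × ℝ) × (ℝ × ℝ)) (θ : ℝ) :
    HasDerivAt (pertTerm K.planeCurve q)
      (pertDeriv K.planeCurve q θ - deriv K.planeCurve θ, 0) θ := by
  have hγd : Differentiable ℝ K.planeCurve := (contDiff_planeCurve hK).differentiable (by simp)
  exact ((hasDerivAt_pert hγd q θ).sub (hγd θ).hasDerivAt).prodMk (hasDerivAt_const θ (0 : ℝ))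

/-- The size of the derivative of the perturbation term: `‖P' θ‖ ≤ ‖v‖ + ‖w‖`. [folklore] -/
theorem norm_deriv_pertTerm_le {K : Knot} (hK : ∀ x, K x ≠ northPole) (q : (ℝ × ℝ) × (ℝ × ℝ)) (θ : ℝ) :
    ‖deriv (pertTerm K.planeCurve q) θ‖ ≤ ‖q.1‖ + ‖q.2‖ := by
  rw [(hasDerivAt_pertTerm hK q θ).deriv, Prod.norm_mk, norm_zero, max_eq_left (norm_nonneg _)]
  exact norm_pertDeriv_sub_le q θ

/-- **A knot with a generic perturbed plane curve is in general position**: if the plane curve of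
`K'` is `pert γ q` with `q` as produced by `exists_pert_generic`, then `K'` is in general position.
[folklore] -/
theorem inGeneralPosition_of_generic {K' : Knot} (hK' : ∀ x, K' x ≠ northPole) {γ : ℝ → ℝ × ℝ}
    (hγ : ContDiff ℝ ∞ γ) {q : (ℝ × ℝ) × (ℝ × ℝ)} (hplane : K'.planeCurve = pert γ q)
    (himm : ∀ s, pertDeriv γ q s ≠ 0)
    (htrans : ∀ s t, ¬ (Real.cos s = Real.cos t ∧ Real.sin s = Real.sin t) →
      pert γ q s = pert γ q t → cross (pertDeriv γ q s) (pertDeriv γ q t) ≠ 0)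
    (htriple : q ∉ pertBad₃ γ) : K'.InGeneralPosition where
  ne_northPole := hK'
  deriv_ne_zero t := by
    rw [hplane, deriv_pert (hγ.differentiable (by simp))]
    exact himm t
  transverse s t hst := by
    rw [hplane] at hst ⊢
    by_cases hcp : circlePoint s = circlePoint t
    · exact Or.inl hcp
    · refine Or.inr ?_
      rw [deriv_pert (hγ.differentiable (by simp)), deriv_pert (hγ.differentiable (by simp))]
      exact htrans s t (fun hc ↦ hcp (circlePoint_eq_iff.2 hc)) hst
  no_triple s t u h1 h2 := by
    rw [hplane] at h1 h2
    by_contra hnot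
    push Not at hnot
    obtain ⟨hst, htu, hsu⟩ := hnot
    exact htriple ⟨s, t, u, fun hc ↦ hst (circlePoint_eq_iff.2 hc),
      fun hc ↦ htu (circlePoint_eq_iff.2 hc), fun hc ↦ hsu (circlePoint_eq_iff.2 hc), h1, h2⟩

/-- **Every knot is isotopic to a knot in general position.** Reidemeister (1932), Kap. I §1;
Cromwell (2004), Thm. 3.2.1; smooth general position after Milnor (1965), §§2–3.
[cite: Cromwell2004, Thm. 3.2.1] -/
theorem exists_isIsotopic_inGeneralPosition (K : Knot) :
    ∃ K' : Knot, K.IsIsotopic K' ∧ K'.InGeneralPosition := by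
  -- 1. off the north pole
  obtain ⟨K₀, hKK₀, hK₀⟩ := K.exists_isIsotopic_forall_ne northPole
  -- 2. the stability bound of the chart curve of `K₀`
  obtain ⟨ε, hε, hiso⟩ := exists_isIsotopic_stereoCurve_add hK₀
  -- 3. a generic small parameter for the plane curve of `K₀`
  have hγ : ContDiff ℝ ∞ K₀.planeCurve := contDiff_planeCurve hK₀
  obtain ⟨q, hq, himm, htrans, htriple⟩ := exists_pert_generic hγ hε
  -- the perturbed knot
  obtain ⟨K', hK₀K', hK', hcurve⟩ := hiso (pertTerm K₀.planeCurve q) (contDiff_pertTerm hK₀ q)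
    (periodic_pertTerm K₀ q) (fun θ ↦ (norm_pertTerm_le K₀ q θ).trans hq.le)
    (fun θ ↦ (norm_deriv_pertTerm_le hK₀ q θ).trans hq.le)
  have hplane : K'.planeCurve = pert K₀.planeCurve q := by
    funext θ
    rw [planeCurve_eq_fst_comp, comp_apply, hcurve]
    show (K₀.stereoCurve θ + pertTerm K₀.planeCurve q θ).1 = pert K₀.planeCurve q θ
    rw [stereoCurve_add_pertTerm]
  -- 4. general position
  exact ⟨K', SphereEmbedding.IsIsotopic.trans_holds hKK₀ hK₀K',
    inGeneralPosition_of_generic hK' hγ hplane himm htrans htriple⟩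

/-- **Discharge of the named fact `Knot.exists_hasGaussDiagram_of_isIsotopic`** (D-0014): every
knot is ambient isotopic to a knot which has a Gauss diagram, namely to a knot in general position
with respect to the stereographic projection from the north pole (`exists_isIsotopic_inGeneralPosition`:
off the pole by homogeneity, a Lebesgue-generic `C¹`-small first-harmonic perturbation of the
plane curve realised by an ambient isotopy through the isotopy extension theorem), whose Gauss
diagram is read off its finitely many transverse crossings
(`InGeneralPosition.hasGaussDiagram`). Reidemeister, *Knotentheorie* (1932), Kap. I §1;
Cromwell (2004), Thm. 3.2.1 ("A tame link has a regular projection") and Def. 3.3.1;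
Rolfsen (1976), §3.E. [cite: Reidemeister1932, Kap. I §1] -/
theorem exists_hasGaussDiagram_of_isIsotopic_holds : exists_hasGaussDiagram_of_isIsotopic := by
  intro K
  obtain ⟨K', hKK', hgp⟩ := exists_isIsotopic_inGeneralPosition K
  exact ⟨K', hgp.gaussDiagram, hKK', hgp.hasGaussDiagram⟩

end Knot

end Literature.Topology.FourManifolds
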